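import Literature.AlgebraicGeometry.Resolution.LogRegularAtlasLinks
import Literature.AlgebraicGeometry.Resolution.LogBlowupOrthantRelative
import Literature.AlgebraicGeometry.Resolution.LogRegularResolutionHolds
import Literature.AlgebraicGeometry.Resolution.BlowupResolutionChartGlue
import Literature.Geometry.PolyhedralFans.LinkedRefinement
import HarnessLib

/-!
# Kato 1994 (10.4), ATLAS form: resolution of log regular schemes with a Zariski fs atlas,
# from the regular projective subdivision of the linked family of chart fans

`Literature/AlgebraicGeometry/Resolution/LogRegularResolutionGeneral.lean`. K. Kato, *Toric
singularities*, Amer. J. Math. 116 (1994), (10.4): a log regular scheme `X` is resolved by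
`X ×_{F(X)} F'` for a regular projective subdivision `F'` of its fan `F(X)` ((9.8) = [KKMS]).
With a `LogRegularAtlas` (finitely many affine fs charts `φ_i : P_i → Γ(X, U_i)`) the fan is seen
chart by chart: the cones `σ_i = P_i^∨ ⊆ ℚ^{n_i}` LINKED along the faces `F_{i,y}^⊥ ∩ σ_i ≅
F_{j,y}^⊥ ∩ σ_j` at the points `y ∈ U_i ∩ U_j` (`LogRegularAtlasLinks.lean`). This file proves
the atlas form of (10.4) FROM the fan-side statement `Fan.LinkedRegularRefinementFamily`
([KempfEtAl1973] Ch. II §2 Thm. 11* presented by charts, `LinkedRefinement.lean`):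

* `chartCone`, `chartFan`, `faceCone`, `linkAt`, `links` — the linked family of face fans of the
  `σ_i` attached to an atlas (`faceCone_isFaceOf`: `F_{i,y}^⊥ ∩ σ_i` is a face; `linkAt` packages
  `LogRegularAtlas.linkMap` as a `Fan.FamilyLink`);
* `LogBlowup.exists_add_mem_piece` — the SATURATION STEP of the compatibility: if `⟨q, ·⟩ ≥ k f`
  on the face `F^⊥ ∩ P^∨` then `q + g ∈ Γ_k` for some `g ∈ F` (add a large multiple of an
  element of `F` positive off the face);
* `germ_span_mul_subset` — at `y ∈ U_i ∩ U_j`, the germs of `φ_i(s_i)` lie in the monoid ideal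
  of `M_y` generated by the germs of `φ_j(s_j)` (partners under the link, value-compatibility of
  the support functions, saturation step, `Γ_k = s_j + P_j`);
* `exists_compatible_regular_charts` — hypothesis `H` of
  `Kato1994_logRegular_hasResolution_general_of_charts`: per chart the generators `s_i` of the
  degree-`k` piece (`k` a COMMON Veronese degree) of the section monoid of the member-`i`
  refinement; compatible on overlaps (`LogRegularAtlas.map_germ_span_eq_of_mul_chartStalkMonoid_eq`);
  blow-up charts regular by Kato (10.3) (`LogRefinedChart.isRegularLocalRing_localization_chartAlgebra`,
  the chart monoids being orthant-like by `LogBlowup.exists_finset_isOrthantLike_of_isStrictSupport`);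
* `Kato1994_logRegular_hasResolution_general_of_linkedRegularRefinementFamily` — **the atlas form
  of Kato (10.4), conditional only on the fan-side statement.**

References: [Kato1994] (9.8), (10.1), (10.3), (10.4); [KempfEtAl1973] Ch. I §2 Thm. 11, Ch. II §2;
[Niziol2006] Thm. 5.8.
-/

noncomputable section

open AlgebraicGeometry CategoryTheory TopologicalSpace Opposite
open PointedCone Literature.Geometry.PolyhedralFans
open scoped Pointwise
open Literature.Combinatorics.Optimization.HilbertBasis (toRat toRat_add toRat_zero toRat_nsmul)

namespace Literature.AlgebraicGeometry.Resolution

universe u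

/-! ### The saturation step (fan level) -/

namespace LogBlowup

variable {n : ℕ}

/-- **Saturation step.** Let `F ≤ P ⊆ ℤⁿ`, `R` a fan with support `P^∨` and cone-wise linear
data `m` with value function `f`, `k ∈ ℕ` and `q ∈ ℤⁿ` with `k f ≤ ⟨q, ·⟩` on the face
`F^⊥ ∩ P^∨`. Then `q + g ∈ Γ_k` for some `g ∈ F`: add `N g₀` for `g₀ ∈ F` positive on the finitely
many cone generators off the face. [cite: Kato1994, (10.4)] -/
theorem exists_add_mem_piece (P F : AddSubmonoid (Fin n → ℤ)) (hFP : F ≤ P) (R : Fan ℚ (Fin n → ℚ))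
    (hsupp : R.support = (dualCone P : Set (Fin n → ℚ))) (m : PointedCone ℚ (Fin n → ℚ) → (Fin n → ℚ))
    (f : (Fin n → ℚ) → ℚ) (hmf : ∀ ρ ∈ R.cones, ∀ x ∈ ρ, m ρ ⬝ᵥ x = f x) (k : ℕ) (q : Fin n → ℤ)
    (hq : ∀ v ∈ dualCone P, (∀ g ∈ F, toRat g ⬝ᵥ v = 0) → (k : ℚ) * f v ≤ toRat q ⬝ᵥ v) :
    ∃ g ∈ F, q + g ∈ piece R m k := by
  classical
  -- generators of the cones
  let gens : PointedCone ℚ (Fin n → ℚ) → Finset (Fin n → ℚ) := fun ρ =>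
    if h : ρ ∈ R.cones then (R.fg h).choose else ∅
  have hgens : ∀ ρ ∈ R.cones, PointedCone.hull ℚ (gens ρ : Set (Fin n → ℚ)) = ρ := by
    intro ρ hρ; simp only [gens, dif_pos hρ]; exact (R.fg hρ).choose_spec
  let G : Finset (Fin n → ℚ) := R.finite.toFinset.biUnion gens
  have hGσ : ∀ g ∈ G, g ∈ dualCone P := by
    intro g hg
    obtain ⟨ρ, hρ, hgρ⟩ := Finset.mem_biUnion.1 hg
    have hρ' : ρ ∈ R.cones := R.finite.mem_toFinset.1 hρ
    have : g ∈ R.support := Fan.mem_support.2 ⟨ρ, hρ', by rw [← hgens ρ hρ']; exact PointedCone.subset_hull hgρ⟩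
    rwa [hsupp] at this
  -- an element of `F` positive at the generators off the face
  let e : (Fin n → ℚ) → (Fin n → ℤ) := fun g =>
    if h : ∃ g₁ ∈ F, toRat g₁ ⬝ᵥ g ≠ 0 then h.choose else 0
  have heF : ∀ g, e g ∈ F := by
    intro g
    simp only [e]
    split_ifs with h
    · exact h.choose_spec.1
    · exact F.zero_mem
  have henn : ∀ g ∈ G, ∀ g', 0 ≤ toRat (e g') ⬝ᵥ g := fun g hg g' =>
    (mem_dualCone_iff P).1 (hGσ g hg) _ (hFP (heF g'))
  have hepos : ∀ g ∈ G, (¬ ∀ g₁ ∈ F, toRat g₁ ⬝ᵥ g = 0) → 0 < toRat (e g) ⬝ᵥ g := by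
    intro g hg hoff
    have h : ∃ g₁ ∈ F, toRat g₁ ⬝ᵥ g ≠ 0 := by
      by_contra h'
      push Not at h'
      exact hoff h'
    have hne : toRat (e g) ⬝ᵥ g ≠ 0 := by
      simp only [e, dif_pos h]
      exact h.choose_spec.2
    exact lt_of_le_of_ne (henn g hg g) hne.symm
  let g₀ : Fin n → ℤ := ∑ g ∈ G, e g
  have hg₀F : g₀ ∈ F := F.sum_mem fun g _ => heF g
  have hg₀ : ∀ g ∈ G, toRat (e g) ⬝ᵥ g ≤ toRat g₀ ⬝ᵥ g := by
    intro g hg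
    have : toRat g₀ = ∑ g' ∈ G, toRat (e g') := by
      simp only [g₀]
      exact Literature.Combinatorics.Optimization.HilbertBasis.toRat_sum G e
    rw [this, sum_dotProduct]
    exact Finset.single_le_sum (f := fun g' => toRat (e g') ⬝ᵥ g) (fun g' _ => henn g hg g') hg
  have hg₀nn : ∀ g ∈ G, 0 ≤ toRat g₀ ⬝ᵥ g := fun g hg => (henn g hg g).trans (hg₀ g hg)
  -- the multiple
  let N : ℕ := ∑ g ∈ G, ⌈((k : ℚ) * f g - toRat q ⬝ᵥ g) / (toRat g₀ ⬝ᵥ g)⌉₊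
  have hN : ∀ g ∈ G, (¬ ∀ g₁ ∈ F, toRat g₁ ⬝ᵥ g = 0) →
      (k : ℚ) * f g - toRat q ⬝ᵥ g ≤ (N : ℚ) * (toRat g₀ ⬝ᵥ g) := by
    intro g hg hoff
    have hd : 0 < toRat g₀ ⬝ᵥ g := lt_of_lt_of_le (hepos g hg hoff) (hg₀ g hg)
    have h1 : ((k : ℚ) * f g - toRat q ⬝ᵥ g) / (toRat g₀ ⬝ᵥ g) ≤
        (⌈((k : ℚ) * f g - toRat q ⬝ᵥ g) / (toRat g₀ ⬝ᵥ g)⌉₊ : ℚ) := Nat.le_ceil _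
    have h2 : (⌈((k : ℚ) * f g - toRat q ⬝ᵥ g) / (toRat g₀ ⬝ᵥ g)⌉₊ : ℚ) ≤ (N : ℚ) := by
      exact_mod_cast Finset.single_le_sum (f := fun g' =>
        ⌈((k : ℚ) * f g' - toRat q ⬝ᵥ g') / (toRat g₀ ⬝ᵥ g')⌉₊) (fun _ _ => Nat.zero_le _) hg
    rw [div_le_iff₀ hd] at h1
    exact h1.trans (mul_le_mul_of_nonneg_right h2 hd.le)
  refine ⟨N • g₀, F.nsmul_mem hg₀F N, ?_⟩
  rw [mem_piece_iff, mem_secMonoid_iff_gens R m gens hgens]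
  intro ρ hρ g hg
  have hgG : g ∈ G := Finset.mem_biUnion.2 ⟨ρ, R.finite.mem_toFinset.2 hρ, hg⟩
  have hgρ : g ∈ ρ := by rw [← hgens ρ hρ]; exact PointedCone.subset_hull hg
  have hval : m ρ ⬝ᵥ g = f g := hmf ρ hρ g hgρ
  simp only
  rw [sub_dotProduct, smul_dotProduct, smul_eq_mul, hval, toRat_add, toRat_nsmul, add_dotProduct,
    smul_dotProduct, smul_eq_mul, sub_nonneg]
  by_cases hon : ∀ g₁ ∈ F, toRat g₁ ⬝ᵥ g = 0
  · have h1 := hq g (hGσ g hgG) hon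
    have h2 : 0 ≤ (N : ℚ) * (toRat g₀ ⬝ᵥ g) := mul_nonneg (Nat.cast_nonneg N) (hg₀nn g hgG)
    linarith
  · have h1 := hN g hgG hon
    linarith

end LogBlowup

/-! ### The linked family of chart fans of an atlas -/

namespace LogRegularAtlas

variable {X : Scheme.{u}} (𝒜 : LogRegularAtlas X)

/-- The cone `σ_i = P_i^∨ ⊆ ℚ^{n_i}` of the chart `i`. [cite: Kato1994, (9.6) and (10.1)] -/
def chartCone (i : 𝒜.ι) : PointedCone ℚ (Fin (𝒜.n i) → ℚ) := LogBlowup.dualCone (𝒜.P i)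

/-- `σ_i` is finitely generated. [cite: Kato1994, (9.6)] -/
theorem chartCone_fg (i : 𝒜.ι) : (𝒜.chartCone i).FG := LogBlowup.dualCone_fg (𝒜.P i) (𝒜.fg i)

/-- `σ_i` is salient. [cite: Kato1994, (9.6)] -/
theorem isSalient_chartCone (i : 𝒜.ι) : IsSalient (𝒜.chartCone i) :=
  LogBlowup.isSalient_dualCone (𝒜.P i) (𝒜.span_eq_top i)

/-- The face fan of `σ_i`. [cite: Kato1994, (9.6)] -/
def chartFan (i : 𝒜.ι) : Fan ℚ (Fin (𝒜.n i) → ℚ) :=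
  Fan.ofCone (𝒜.chartCone i) (𝒜.chartCone_fg i) (𝒜.isSalient_chartCone i)

/-- The face fans are rational. [cite: KempfEtAl1973, Ch. I §1] -/
theorem chartFan_isRational (i : 𝒜.ι) : (𝒜.chartFan i).IsRational := by
  classical
  exact Fan.isRational_ofCone (𝒜.chartCone_fg i) (𝒜.isSalient_chartCone i)

/-- **The face of `σ_i` at a point** `y ∈ U_i`: `F_{i,y}^⊥ ∩ σ_i`, the dual cone of the sharp
quotient `P_i/F_{i,y} ≅ M_y/𝒪^*_y`. [cite: Kato1994, (10.1)] -/
def faceCone (i : 𝒜.ι) (y : X) (hy : y ∈ (𝒜.U i : X.Opens)) : PointedCone ℚ (Fin (𝒜.n i) → ℚ) where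
  carrier := {v | v ∈ 𝒜.chartCone i ∧ ∀ g ∈ 𝒜.faceAt i y hy, toRat g ⬝ᵥ v = 0}
  zero_mem' := ⟨(𝒜.chartCone i).zero_mem, fun g _ => by rw [dotProduct_zero]⟩
  add_mem' := by
    rintro v w ⟨hv, hv'⟩ ⟨hw, hw'⟩
    exact ⟨(𝒜.chartCone i).add_mem hv hw, fun g hg => by rw [dotProduct_add, hv' g hg, hw' g hg, add_zero]⟩
  smul_mem' := by
    rintro c v ⟨hv, hv'⟩
    refine ⟨Submodule.smul_mem _ c hv, fun g hg => ?_⟩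
    rw [Nonneg.mk_smul, dotProduct_smul, hv' g hg, smul_zero]

/-- Membership in the face at `y`. [cite: Kato1994, (10.1)] -/
theorem mem_faceCone_iff {i : 𝒜.ι} {y : X} (hy : y ∈ (𝒜.U i : X.Opens)) {v : Fin (𝒜.n i) → ℚ} :
    v ∈ 𝒜.faceCone i y hy ↔ v ∈ 𝒜.chartCone i ∧ ∀ g ∈ 𝒜.faceAt i y hy, toRat g ⬝ᵥ v = 0 :=
  Iff.rfl

/-- The face at `y` is a face of `σ_i`. [cite: Kato1994, (10.1)] -/
theorem faceCone_isFaceOf (i : 𝒜.ι) (y : X) (hy : y ∈ (𝒜.U i : X.Opens)) :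
    (𝒜.faceCone i y hy).IsFaceOf (𝒜.chartCone i) := by
  refine ⟨fun v hv => hv.1, fun {v w a} hv hw ha hvw => ⟨hv, fun g hg => ?_⟩⟩
  have hgP : g ∈ 𝒜.P i := 𝒜.faceAt_le i y hy hg
  have h1 : 0 ≤ toRat g ⬝ᵥ v := (LogBlowup.mem_dualCone_iff _).1 hv g hgP
  have h2 : 0 ≤ toRat g ⬝ᵥ w := (LogBlowup.mem_dualCone_iff _).1 hw g hgP
  have h3 := hvw.2 g hg
  rw [dotProduct_add, dotProduct_smul] at h3
  have h4 : (a : ℚ) * (toRat g ⬝ᵥ v) + toRat g ⬝ᵥ w = 0 := by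
    simpa [Nonneg.mk_smul, smul_eq_mul] using h3
  have ha' : (0 : ℚ) < a := by exact_mod_cast ha
  nlinarith

/-- The face at `y` is a cone of the face fan. [cite: Kato1994, (10.1)] -/
theorem faceCone_mem (i : 𝒜.ι) (y : X) (hy : y ∈ (𝒜.U i : X.Opens)) :
    𝒜.faceCone i y hy ∈ (𝒜.chartFan i).cones :=
  Fan.mem_ofCone_iff.2 (𝒜.faceCone_isFaceOf i y hy)

/-- **The link at `y ∈ U_i ∩ U_j`** as a `Fan.FamilyLink` of the face fans: the faces
`F_{i,y}^⊥ ∩ σ_i ≅ F_{j,y}^⊥ ∩ σ_j` under `linkMap` (`LogRegularAtlasLinks.lean`).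
[cite: Kato1994, (10.1)] -/
def linkAt (i j : 𝒜.ι) (y : X) (hi : y ∈ (𝒜.U i : X.Opens)) (hj : y ∈ (𝒜.U j : X.Opens)) :
    Fan.FamilyLink 𝒜.n 𝒜.chartFan where
  i := i
  j := j
  src := 𝒜.faceCone i y hi
  tgt := 𝒜.faceCone j y hj
  src_mem := 𝒜.faceCone_mem i y hi
  tgt_mem := 𝒜.faceCone_mem j y hj
  toLin := 𝒜.linkMap hi hj
  invLin := 𝒜.linkMap hj hi
  mapsTo := fun v hv =>
    ⟨(LogBlowup.mem_dualCone_iff _).2 fun q hq =>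
        𝒜.linkMap_nonneg hi hj hv.2 (fun p => (LogBlowup.mem_dualCone_iff _).1 hv.1 _ p.2) ⟨q, hq⟩,
      𝒜.linkMap_orth hi hj hv.2⟩
  mapsTo_inv := fun v hv =>
    ⟨(LogBlowup.mem_dualCone_iff _).2 fun q hq =>
        𝒜.linkMap_nonneg hj hi hv.2 (fun p => (LogBlowup.mem_dualCone_iff _).1 hv.1 _ p.2) ⟨q, hq⟩,
      𝒜.linkMap_orth hj hi hv.2⟩
  left_inv := fun v hv => 𝒜.linkMap_linkMap hi hj hv.2
  right_inv := fun v hv => 𝒜.linkMap_linkMap hj hi hv.2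
  integral := fun v _ hvN => by
    obtain ⟨w, hw⟩ : ∃ w : Fin (𝒜.n i) → ℤ, v = toRat w := by
      choose c hc using hvN
      exact ⟨fun a => c a, funext fun a => hc a⟩
    rw [hw, 𝒜.linkMap_integral hi hj w]
    exact fun a => ⟨_, rfl⟩
  integral_inv := fun v _ hvN => by
    obtain ⟨w, hw⟩ : ∃ w : Fin (𝒜.n j) → ℤ, v = toRat w := by
      choose c hc using hvN
      exact ⟨fun a => c a, funext fun a => hc a⟩
    rw [hw, 𝒜.linkMap_integral hj hi w]
    exact fun a => ⟨_, rfl⟩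

/-- The set of all links of the atlas. [cite: Kato1994, (10.1)] -/
def links : Set (Fan.FamilyLink 𝒜.n 𝒜.chartFan) :=
  {ℓ | ∃ (i j : 𝒜.ι) (y : X) (hi : y ∈ (𝒜.U i : X.Opens)) (hj : y ∈ (𝒜.U j : X.Opens)),
    ℓ = 𝒜.linkAt i j y hi hj}

/-- `linkAt i j y ∈ links`. [cite: Kato1994, (10.1)] -/
theorem linkAt_mem (i j : 𝒜.ι) (y : X) (hi : y ∈ (𝒜.U i : X.Opens)) (hj : y ∈ (𝒜.U j : X.Opens)) :
    𝒜.linkAt i j y hi hj ∈ 𝒜.links :=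
  ⟨i, j, y, hi, hj, rfl⟩

/-! ### Compatible chart ideals with regular blow-up charts -/

/-- **Hypothesis `H` of `Kato1994_logRegular_hasResolution_general_of_charts`, from the fan-side
statement.** For a log regular atlas: take the linked regular projective refinement of the family
of face fans of the `σ_i = P_i^∨` (`Fan.LinkedRegularRefinementFamily` applied to `links`), a
COMMON Veronese degree `k` of the section monoids, and `s_i ⊆ P_i` generating the degree-`k`
pieces. Then (1) every `s_i` is non-empty; (2) at `y ∈ U_i ∩ U_j` the germs of `φ_i(s_i)` and
`φ_j(s_j)` generate the same ideal of `𝒪_{X,y}` — a germ `φ_i(a)_y`, `a ∈ s_i`, is a unit times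
`φ_j(q)_y` for a partner `q`, `⟨q, ·⟩ = ⟨a, E·⟩ ≥ k f_i ∘ E = k f_j` on the face at `y` (pairing
and value compatibility of the link), so `q + g ∈ Γ_k^{(j)} = s_j + P_j` for some `g ∈ F_{j,y}`
(saturation step), whence `φ_i(a)_y ∈ φ_j(s_j)_y · M_y`; (3) every localization of every
blow-up chart ring `Γ(X, U_i)[(φ_i(s_i))/φ_i(a)]` is regular: its chart monoid is orthant-like
and Kato (10.3) applies (`LogRefinedChart.isRegularLocalRing_localization_chartAlgebra`).
[cite: Kato1994, (10.4) with (9.8), (10.1), (10.3)] [cite: KempfEtAl1973, Ch. II §2] -/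
theorem exists_compatible_regular_charts (hK : Fan.LinkedRegularRefinementFamily) :
    ∃ s : ∀ i, Finset (𝒜.P i),
      (∀ i, (s i).Nonempty) ∧
      (∀ (i j : 𝒜.ι) (y : X) (hi : y ∈ (𝒜.U i : X.Opens)) (hj : y ∈ (𝒜.U j : X.Opens)),
        (Ideal.span ((fun p : 𝒜.P i => 𝒜.φ i (Multiplicative.ofAdd p)) '' (s i : Set (𝒜.P i)))).map
            (X.presheaf.germ (𝒜.U i : X.Opens) y hi).hom =
          (Ideal.span ((fun p : 𝒜.P j => 𝒜.φ j (Multiplicative.ofAdd p)) '' (s j : Set (𝒜.P j)))).map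
            (X.presheaf.germ (𝒜.U j : X.Opens) y hj).hom) ∧
      (∀ i, ∀ a ∈ s i, ∀ (𝔓 : Ideal (blowupAlgebra
          (Ideal.span ((fun p : 𝒜.P i => 𝒜.φ i (Multiplicative.ofAdd p)) '' (s i : Set (𝒜.P i))))
          (𝒜.φ i (Multiplicative.ofAdd a)))) [𝔓.IsPrime],
        IsRegularLocalRing (Localization.AtPrime 𝔓)) := by
  classical
  haveI := 𝒜.finite
  haveI : Fintype 𝒜.ι := Fintype.ofFinite 𝒜.ι
  obtain ⟨l, f, hmem, hlink⟩ := hK 𝒜.ι 𝒜.n 𝒜.chartFan 𝒜.chartFan_isRational 𝒜.links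
  have hσmem : ∀ i, 𝒜.chartCone i ∈ (𝒜.chartFan i).cones := fun i =>
    Fan.mem_ofCone_iff.2 (PointedCone.IsFaceOf.refl _)
  -- the refinements restricted to the top cones, and their support data
  set R : ∀ i, Fan ℚ (Fin (𝒜.n i) → ℚ) := fun i =>
    ((𝒜.chartFan i).starIter (l i)).restrict (𝒜.chartCone i) with hR
  have hsuppR : ∀ i, (R i).support = (LogBlowup.dualCone (𝒜.P i) : Set (Fin (𝒜.n i) → ℚ)) :=
    fun i => ((hmem i).2.2.2.2.2 (hσmem i)).1
  have hdata := fun i => ((hmem i).2.2.2.2.2 (hσmem i)).2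
  choose m hm hmprop using hdata
  have hRreg : ∀ i, (R i).IsRegular := fun i ρ hρ => (hmem i).2.2.1 hρ.1
  -- a common Veronese degree
  have hver₀ := fun i => exists_veronese (R i) (m i)
  choose kf hkf hkver using hver₀
  set k : ℕ := ∏ i, kf i with hk
  have hkpos : 0 < k := Finset.prod_pos fun i _ => hkf i
  have hver : ∀ i, ∀ j : ℕ, 0 < j → ∀ u ∈ piece (R i) (m i) (j * k),
      ∃ us : Fin j → Fin (𝒜.n i) → ℤ, (∀ t, us t ∈ piece (R i) (m i) k) ∧ u = ∑ t, us t := by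
    intro i
    have hc : 0 < ∏ j ∈ Finset.univ.erase i, kf j := Finset.prod_pos fun j _ => hkf j
    have hkeq : k = (∏ j ∈ Finset.univ.erase i, kf j) * kf i := by
      rw [hk, Finset.prod_erase_mul _ _ (Finset.mem_univ i)]
    rw [hkeq]
    exact LogBlowup.veronese_mul (R i) (m i) (hkver i) hc
  -- the chart generators
  have hM2 := fun i => LogBlowup.exists_finset_isOrthantLike_of_isStrictSupport (𝒜.P i) (𝒜.fg i)
    (𝒜.saturated i) (R i) (hsuppR i) (hRreg i) (m i) (hm i) (fun ρ hρ => (hmprop i ρ hρ).1)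
    (fun ρ hρ x hx => (hmprop i ρ hρ).2.1 x hx) hkpos (hver i)
  choose s hsne hsΓ hΓs horth using hM2
  refine ⟨s, hsne, fun i j y hi hj => ?_, fun i a ha 𝔓 _ => ?_⟩
  · -- (2) compatibility
    -- one inclusion, for any ordered pair of charts
    have key : ∀ (i j : 𝒜.ι) (hi : y ∈ (𝒜.U i : X.Opens)) (hj : y ∈ (𝒜.U j : X.Opens)),
        ((fun p : 𝒜.P i => (X.presheaf.germ (𝒜.U i : X.Opens) y hi).hom
            (𝒜.φ i (Multiplicative.ofAdd p))) '' (s i : Set (𝒜.P i))) *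
          (chartStalkMonoid (𝒜.U j : X.Opens) (𝒜.φ j) y hj : Set (X.presheaf.stalk y)) ⊆
        ((fun p : 𝒜.P j => (X.presheaf.germ (𝒜.U j : X.Opens) y hj).hom
            (𝒜.φ j (Multiplicative.ofAdd p))) '' (s j : Set (𝒜.P j))) *
          (chartStalkMonoid (𝒜.U j : X.Opens) (𝒜.φ j) y hj : Set (X.presheaf.stalk y)) := by
      intro i j hi hj
      rintro _ ⟨_, ⟨a, ha, rfl⟩, μ, hμ, rfl⟩
      have ha' : a ∈ s i := Finset.mem_coe.1 ha
      obtain ⟨q, hq⟩ := 𝒜.exists_rel hi hj a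
      -- `q` satisfies the face inequality for chart `j`
      have hqface : ∀ v ∈ LogBlowup.dualCone (𝒜.P j), (∀ g ∈ 𝒜.faceAt j y hj, toRat g ⬝ᵥ v = 0) →
          (k : ℚ) * f j v ≤ toRat (q : Fin (𝒜.n j) → ℤ) ⬝ᵥ v := by
        intro v hv hv0
        have hvt : v ∈ 𝒜.faceCone j y hj := ⟨hv, hv0⟩
        set w := 𝒜.linkMap hj hi v with hw_def
        have hw : w ∈ 𝒜.faceCone i y hi := (𝒜.linkAt j i y hj hi).mapsTo v hvt
        have hEw : 𝒜.linkMap hi hj w = v := 𝒜.linkMap_linkMap hj hi hvt.2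
        have hpair := 𝒜.linkMap_pairing hi hj hw.2 hq
        rw [hEw] at hpair
        have hval : f j (𝒜.linkMap hi hj w) = f i w :=
          (hlink _ (𝒜.linkAt_mem i j y hi hj)).2.2 w hw
        rw [hEw] at hval
        have haw : (k : ℚ) * f i w ≤ toRat (a : Fin (𝒜.n i) → ℤ) ⬝ᵥ w := by
          have hwsupp : w ∈ (R i).support := by rw [hsuppR i]; exact hw.1
          obtain ⟨ρ, hρ, hwρ⟩ := Fan.mem_support.1 hwsupp
          have h1 := (mem_secMonoid_iff (R i) (m i)).1 (hsΓ i a ha') ρ hρ w hwρ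
          simp only at h1
          rw [sub_dotProduct, smul_dotProduct, smul_eq_mul, (hmprop i ρ hρ).2.2 w hwρ,
            sub_nonneg] at h1
          exact h1
        rw [hval, hpair]
        exact haw
      obtain ⟨g, hgF, hqg⟩ := LogBlowup.exists_add_mem_piece (𝒜.P j) (𝒜.faceAt j y hj)
        (𝒜.faceAt_le j y hj) (R j) (hsuppR j) (m j) (f j) (fun ρ hρ x hx => (hmprop j ρ hρ).2.2 x hx)
        k q hqface
      obtain ⟨b, hb, hz⟩ := hΓs j _ hqg
      have hgP : g ∈ 𝒜.P j := 𝒜.faceAt_le j y hj hgF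
      set z : 𝒜.P j := ⟨(q : Fin (𝒜.n j) → ℤ) + g - b, hz⟩ with hz_def
      have hsum : q + ⟨g, hgP⟩ = b + z := Subtype.ext (by
        simp only [AddMemClass.coe_add, hz_def]; abel)
      -- germs: `φ_j(q) φ_j(g) = φ_j(b) φ_j(z)` at `y`
      set γ := (X.presheaf.germ (𝒜.U j : X.Opens) y hj).hom with hγ
      have hφ0 : 𝒜.φ j (Multiplicative.ofAdd q) * 𝒜.φ j (Multiplicative.ofAdd (⟨g, hgP⟩ : 𝒜.P j)) =
          𝒜.φ j (Multiplicative.ofAdd b) * 𝒜.φ j (Multiplicative.ofAdd z) := by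
        have h0 : 𝒜.φ j (Multiplicative.ofAdd (q + ⟨g, hgP⟩)) = 𝒜.φ j (Multiplicative.ofAdd (b + z)) := by
          rw [hsum]
        rwa [ofAdd_add, ofAdd_add, map_mul, map_mul] at h0
      have hφ : γ (𝒜.φ j (Multiplicative.ofAdd q)) * γ (𝒜.φ j (Multiplicative.ofAdd (⟨g, hgP⟩ : 𝒜.P j))) =
          γ (𝒜.φ j (Multiplicative.ofAdd b)) * γ (𝒜.φ j (Multiplicative.ofAdd z)) := by
        rw [← map_mul γ, ← map_mul γ, hφ0]
      have hug : IsUnit (γ (𝒜.φ j (Multiplicative.ofAdd (⟨g, hgP⟩ : 𝒜.P j)))) :=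
        (𝒜.coe_mem_faceAt_iff hj ⟨g, hgP⟩).1 hgF
      obtain ⟨u, hu⟩ := hq
      -- `φ_i(a)_y = φ_j(b)_y · (φ_j(z)_y · u_g⁻¹ · u⁻¹)`
      have hrew : (X.presheaf.germ (𝒜.U i : X.Opens) y hi).hom (𝒜.φ i (Multiplicative.ofAdd a)) =
          γ (𝒜.φ j (Multiplicative.ofAdd b)) *
            (γ (𝒜.φ j (Multiplicative.ofAdd z)) * ↑hug.unit⁻¹ * ↑u⁻¹) := by
        have h1 : (X.presheaf.germ (𝒜.U i : X.Opens) y hi).hom (𝒜.φ i (Multiplicative.ofAdd a)) =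
            γ (𝒜.φ j (Multiplicative.ofAdd q)) * ↑u⁻¹ := by
          rw [← hu, Units.mul_inv_cancel_right]
        have h2 : γ (𝒜.φ j (Multiplicative.ofAdd q)) =
            γ (𝒜.φ j (Multiplicative.ofAdd b)) * γ (𝒜.φ j (Multiplicative.ofAdd z)) * ↑hug.unit⁻¹ := by
          rw [← hφ, mul_assoc, IsUnit.mul_val_inv, mul_one]
        rw [h1, h2]; ring
      show (X.presheaf.germ (𝒜.U i : X.Opens) y hi).hom (𝒜.φ i (Multiplicative.ofAdd a)) * μ ∈ _
      rw [hrew, mul_assoc]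
      refine Set.mul_mem_mul ⟨b, Finset.mem_coe.2 hb, rfl⟩ ?_
      -- the second factor lies in `M_y`
      have hzM : γ (𝒜.φ j (Multiplicative.ofAdd z)) ∈ chartStalkMonoid (𝒜.U j : X.Opens) (𝒜.φ j) y hj :=
        Submonoid.mem_sup_right ⟨_, ⟨Multiplicative.ofAdd z, rfl⟩, rfl⟩
      have hunit : ∀ v : (X.presheaf.stalk y)ˣ, (↑v : X.presheaf.stalk y) ∈
          chartStalkMonoid (𝒜.U j : X.Opens) (𝒜.φ j) y hj := fun v =>
        Submonoid.mem_sup_left ((IsUnit.mem_submonoid_iff _).2 (Units.isUnit v))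
      exact Submonoid.mul_mem _ (Submonoid.mul_mem _ (Submonoid.mul_mem _ hzM (hunit _)) (hunit _)) hμ
    apply 𝒜.map_germ_span_eq_of_mul_chartStalkMonoid_eq hi hj
    rw [𝒜.compat i j y hi hj]
    exact le_antisymm (key i j hi hj) (by rw [← 𝒜.compat i j y hi hj]; exact key j i hj hi)
  · -- (3) regularity of the blow-up charts: Kato (10.3)
    haveI := 𝒜.isNoetherianRing i
    obtain ⟨b, I, hQ⟩ := horth i a ha
    exact LogRefinedChart.isRegularLocalRing_localization_chartAlgebra (𝒜.fg i) (𝒜.saturated i)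
      (𝒜.span_eq_top i) (fun 𝔭 _ => 𝒜.isLogRegularAt i 𝔭) hQ
      (LogChart.le_blowupChartMonoid (𝒜.P i) (↑(s i)) a) (LogChart.blowupChart (𝒜.P i) (𝒜.φ i) (↑(s i)) a)
      (fun p => LogChart.blowupChart_of_mem (𝒜.P i) (𝒜.φ i) (↑(s i)) a p)
      (LogChart.adjoin_range_blowupChart_eq_top (𝒜.P i) (𝒜.φ i) (↑(s i)) a)
      (fun L _ g hg => blowupAlgebra_exists_extend _ _ L g (hg a)) 𝔓

end LogRegularAtlas

/-- **Kato 1994, (10.4), atlas form, from the fan side.** If linked families of rational fans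
admit compatible regular projective refinements (`Fan.LinkedRegularRefinementFamily`,
[KempfEtAl1973] Ch. II §2 Thm. 11*), then every scheme with a log regular Zariski fs atlas has a
resolution of singularities: `Kato1994_logRegular_hasResolution_general` (and with it
`Kato1994_logRegularScheme_hasResolution`, `LogRegularAtlasComparison.lean`).
[cite: Kato1994, (10.4)] [cite: Niziol2006, Thm. 5.8] -/
theorem Kato1994_logRegular_hasResolution_general_of_linkedRegularRefinementFamily
    (hK : Fan.LinkedRegularRefinementFamily) : Kato1994_logRegular_hasResolution_general.{u} :=
  Kato1994_logRegular_hasResolution_general_of_charts fun _ 𝒜 => 𝒜.exists_compatible_regular_charts hK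

end Literature.AlgebraicGeometry.Resolution
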